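import Literature.AlgebraicGeometry.AbelianSchemes.AbelianSchemeOverRigidity
import Literature.AlgebraicGeometry.GroupActions.FixedPointSchemeFinitePresentation
import Literature.AlgebraicGeometry.Motives.VarietiesGeometricallyIntegralProofs
import Mathlib.AlgebraicGeometry.Group.Smooth
import Mathlib.AlgebraicGeometry.AlgClosed.Basic
import Mathlib.AlgebraicGeometry.Morphisms.SmoothFiber
import Mathlib.CategoryTheory.Monoidal.Cartesian.GrpLimits
import HarnessLib

/-!
# Products of abelian schemes; the fixed subgroup scheme (= image) of an idempotent endomorphism of an abelian
# scheme is an abelian scheme — the carrier step of Serre's tensor construction `A ⊗_𝒪 𝔟`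

Topic `AlgebraicGeometry/AbelianSchemes`, namespace `Literature.AlgebraicGeometry.AbelianSchemes` (constructions with bodies +
proved theorems; no named fact, no `sorry`, no `instance` declaration, no notation; ANY base scheme `S`, no noetherian hypothesis).
Cell `hodgecm-mathlib`, programme F0/P6 «MOD» (sub-desk P6a, generic organ (g2) «Serre tensor construction», FILE 1 of 2;
`--supports stmt-HodgeConjecture-24832`, count-neutral).  HC_CM is proved only modulo the 2 remaining named inputs (hLiu418,
h413) until rung 0 closes; this file discharges none of them.

## Mathematics

For an abelian scheme `B → S` ([MumfordFogartyKirwan1994, Ch. 6 §1 Def. 6.1]: smooth proper group scheme with geometrically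
connected fibres; equivalently [GortzWedhorn2023, Def. 27.89 / Prop. 27.92]: proper, flat, locally of finite presentation,
fibres geometrically reduced and connected) and an IDEMPOTENT endomorphism `e : B → B` of `S`-group schemes (`e ∘ e = e`), the
fixed subgroup scheme `Fix(e) := Eq(e, 𝟙) ⊆ B` — which for idempotent `e` is the scheme-theoretic IMAGE `e(B)`: `e` co-restricts
to `π : B → Fix(e)` with `π ∘ ι = 𝟙` and `ι ∘ π = e` — is again an abelian scheme, a DIRECT FACTOR of `B`.  Proof: `Fix(e)` is a
retract of `B` over `S`, so (i) `ι` is a closed immersion (equalizer into a separated `S`-scheme) locally of finite presentation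
(★ `GroupActions.locallyOfFinitePresentation_equalizer_ι_left`), hence `Fix(e) → S` is proper and locally of finite presentation;
(ii) `Fix(e) → S` is FLAT: on stalks `𝒪_{Fix(e),x}` is an `𝒪_{S,s}`-module direct summand of the flat `𝒪_{B,ι(x)}` (Mathlib
`Module.Flat.of_retract`); (iii) every geometric fibre `Fix(e)_K` is a retract of the smooth — hence reduced (★
`Motives.isReduced_of_smooth_over_field`) and connected — fibre `B_K`, so it is reduced and connected; (iv) a flat, locally finitely
presented group scheme with geometrically reduced fibres is smooth ([GortzWedhorn2023, Cor. 27.24]; Mathlib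
`AlgebraicGeometry.smooth_of_grpObj` + `Smooth.of_smooth_fiberToSpecResidueField`).  This is the geometric half of SERRE'S TENSOR
CONSTRUCTION: for an action `𝒪 → End_S(A)` and a finitely generated projective `𝒪`-module `𝔟 ≅ E·𝒪ⁿ` (`E² = E ∈ Mₙ(𝒪)`),
`A ⊗_𝒪 𝔟 := Fix(E ↷ Aⁿ)` represents `T ↦ A(T) ⊗_𝒪 𝔟` (FILE 2 `SerreTensorConstruction`; B. Conrad, *Gross–Zagier revisited*
(2004) §7; Z. Amir-Khosravi, *Serre's tensor construction and moduli of abelian schemes*, Manuscripta Math. 156 (2018)).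

## Contents (namespace `…AbelianSchemes`, then `…AbelianSchemes.AbelianSchemeOver`)

* §0 retracts of schemes (`X →i Y →r X`, `i ≫ r = 𝟙`): `isReduced_of_retract`, `flat_comp_of_retract` (over a base `T`);
* §1 `AbelianSchemeOver.prod A B` (carrier `A.X ⊗ B.X`, Mathlib `GrpObj.instTensorObj`), `trivial S` (`𝟙_ (Over S)`), `pow A n`,
  `isCommMonObj_prod∕_pow`;
* §2 for `e : B.X ⟶ B.X`, `[IsMonHom e]`: `fixedGrp e : Grp (Over S)` (the equalizer of `e, 𝟙` in GROUP objects — Mathlib `Grp C`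
  has limits), `fixedOver e : Over S`, `fixedι e : fixedOver e ⟶ B.X` (homomorphism, mono, `.left` a closed immersion locally of
  finite presentation, `fixedι_comp : ι ≫ e = ι`), the comparison `fixedToEqualizer` with `equalizer e (𝟙 _)` in `Over S` (iso);
  for `he : e ≫ e = e`: `fixedπ e he : B.X ⟶ fixedOver e` with `fixedπ_comp_ι : π ≫ ι = e`, `fixedι_comp_π : ι ≫ π = 𝟙`, the
  points `homEquiv : (T ⟶ fixedOver e) ≃ {f : T ⟶ B.X // f ≫ e = f}` (multiplicative);
* §3 `isProper∕locallyOfFinitePresentation∕flat∕geometricallyReduced∕geometricallyConnected∕smooth_fixedOver_hom` and the abelian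
  scheme **`fixed e he : AbelianSchemeOver S`** (`(fixed e he).X = fixedOver e`), `isCommMonObj_fixedOver`.

Base change of `Fix(e)` and the `Mₙ(𝒪)`-action on `Aⁿ` are FILE 2.  Search-before-state (`lean search`): no product ∕ power of
`AbelianSchemeOver` as an abelian scheme in the tree before this file (★ `PoincareSheafBiadditive` §1 proves the three properties
of `B.X ⊗ B.X` for ONE `B`; same proof here for `A.X ⊗ B.X`), no fixed ∕ image scheme of an idempotent, no Serre tensor.

## References
* [MumfordFogartyKirwan1994] D. Mumford, J. Fogarty, F. Kirwan, *Geometric Invariant Theory*, 3rd ed. (1994), Ch. 6 §1 Def. 6.1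
  (p. 115), Cor. 6.5 (p. 117).
* [GortzWedhorn2023] U. Görtz, T. Wedhorn, *Algebraic Geometry II*, (2023): Def. 27.89, Rem. 27.90, Prop. 27.92 (abelian schemes),
  Cor. 27.24 with Prop. 27.10 (1) and Thm. 18.56 (flat lfp group schemes with geometrically reduced fibres are smooth).
* [GortzWedhorn2020] U. Görtz, T. Wedhorn, *Algebraic Geometry I*, 2nd ed. (2020): Def. 3.26 ∕ Prop. 3.27 (reduced), (9.1.4) and
  Prop. 9.5 (diagonal, equalizers), Definition/Proposition B.16 (flat modules).
* Mathlib: `CategoryTheory.Monoidal.Cartesian.GrpLimits` (limits of group objects), `AlgebraicGeometry.Group.Smooth`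
  (`smooth_of_grpObj`), `Morphisms.SmoothFiber`, `Morphisms.Flat` (`Flat.of_stalkMap`), `RingTheory.Flat.Basic` (`Module.Flat.of_retract`),
  `isClosedImmersion_equalizer_ι_left`.  Tree: `AbelianSchemes/AbelianSchemeOverBase`, `…OverRigidity` (`universallyOpen_hom`),
  `GroupActions/FixedPointSchemeFinitePresentation`, `Motives/VarietiesGeometricallyIntegralProofs`.
-/

noncomputable section

universe u

open CategoryTheory CategoryTheory.Limits AlgebraicGeometry MonoidalCategory CartesianMonoidalCategory
open scoped MonObj

namespace Literature.AlgebraicGeometry.AbelianSchemes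

/-! ## §0 Retracts of schemes: reducedness and flatness pass to retracts -/

section Retract

/-- Ring level: if `ρ : M → N` has a ring-homomorphism section `σ` with `σ ∘ ρ ∘ φ = φ`, then `N` is an `A`-module retract
of `M` along `φ : A → M`; a retract (direct summand) of a flat module is flat (Mathlib `Module.Flat.of_retract`). [folklore] -/
private theorem ringHom_flat_comp_of_retract {A M N : Type*} [CommRing A] [CommRing M] [CommRing N]
    (φ : A →+* M) (hφ : φ.Flat) (ρ : M →+* N) (σ : N →+* M) (hρσ : ρ.comp σ = RingHom.id N)
    (hσ : σ.comp (ρ.comp φ) = φ) : (ρ.comp φ).Flat := by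
  algebraize [φ, ρ.comp φ]
  let ρ' : M →ₗ[A] N :=
    { toFun := ρ
      map_add' := fun a b => map_add ρ a b
      map_smul' := fun a m => by
        simp only [Algebra.smul_def, RingHom.algebraMap_toAlgebra, map_mul, RingHom.id_apply, RingHom.comp_apply] }
  let σ' : N →ₗ[A] M :=
    { toFun := σ
      map_add' := fun a b => map_add σ a b
      map_smul' := fun a n => by
        simp only [Algebra.smul_def, RingHom.algebraMap_toAlgebra, map_mul, RingHom.id_apply]
        congr 1
        exact RingHom.congr_fun hσ a }
  have h : ρ'.comp σ' = LinearMap.id := by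
    ext n
    exact RingHom.congr_fun hρσ n
  exact Module.Flat.of_retract σ' ρ' h

variable {X Y : Scheme.{u}} (i : X ⟶ Y) (r : Y ⟶ X)

/-- The stalk retraction: for a retract `X →i Y →r X` (`i ≫ r = 𝟙`) and `x ∈ X`, the composite
`𝒪_{X,x} ≅ 𝒪_{X,r(i(x))} →(r^#) 𝒪_{Y,i(x)} →(i^#) 𝒪_{X,x}` is the identity. [folklore] -/
private theorem stalkMap_retract (hir : i ≫ r = 𝟙 X) (x : X) (hx : r.base (i.base x) = x) :
    (X.presheaf.stalkCongr (.of_eq hx)).inv ≫ r.stalkMap (i.base x) ≫ i.stalkMap x = 𝟙 _ := by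
  rw [← Scheme.Hom.stalkMap_comp, Scheme.Hom.stalkMap_congr_hom (i ≫ r) (𝟙 X) hir x,
    Scheme.Hom.stalkMap_id]
  erw [Category.comp_id]
  simp [TopCat.Presheaf.stalkCongr]

/-- **A retract of a reduced scheme is reduced**: for `X →i Y →r X` with `i ≫ r = 𝟙` and `Y` reduced, every stalk
`𝒪_{X,x} ≅ 𝒪_{X,r(i(x))}` embeds by `r^#` into the reduced ring `𝒪_{Y,i(x)}` (`i^#` is a left inverse).
[cite: GortzWedhorn2020, Definition 3.26 and Proposition 3.27] -/
theorem isReduced_of_retract (hir : i ≫ r = 𝟙 X) [IsReduced Y] : IsReduced X := by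
  haveI : ∀ x : X, _root_.IsReduced (X.presheaf.stalk x) := by
    intro x
    have hx : r.base (i.base x) = x := by
      have := congr($(hir).base x)
      simpa using this
    have h1 := stalkMap_retract i r hir x hx
    rw [Iso.inv_comp_eq, Category.comp_id] at h1
    have hinj : Function.Injective (r.stalkMap (i.base x)).hom := by
      apply Function.LeftInverse.injective
        (g := fun s => (i.stalkMap x ≫ (X.presheaf.stalkCongr (.of_eq hx)).inv).hom s)
      intro s
      have h1' : r.stalkMap (i.base x) ≫ i.stalkMap x ≫ (X.presheaf.stalkCongr (.of_eq hx)).inv = 𝟙 _ := by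
        rw [← Category.assoc, h1, Iso.hom_inv_id]
      have := congr(($h1').hom s)
      simpa using this
    have : _root_.IsReduced (X.presheaf.stalk (r.base (i.base x))) :=
      isReduced_of_injective (r.stalkMap (i.base x)).hom hinj
    exact hx ▸ this
  exact isReduced_of_isReduced_stalk X

/-- **Flatness passes to retracts over a base**: for `X →i Y →r X` over `T` (`i ≫ r = 𝟙`, `q : Y → T`,
`r ≫ i ≫ q = q`) with `q` flat, `i ≫ q : X → T` is flat — on stalks `𝒪_{X,x}` is an `𝒪_{T,t}`-module direct summand of the
flat module `𝒪_{Y,i(x)}`. [cite: GortzWedhorn2020, Definition/Proposition B.16] -/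
theorem flat_comp_of_retract (hir : i ≫ r = 𝟙 X) {T : Scheme.{u}} (q : Y ⟶ T) [Flat q]
    (hr : r ≫ i ≫ q = q) : Flat (i ≫ q) := by
  refine Flat.of_stalkMap _ fun x => ?_
  have hx : r.base (i.base x) = x := by
    have := congr($(hir).base x)
    simpa using this
  have hφ : (q.stalkMap (i.base x)).hom.Flat := Flat.stalkMap q (i.base x)
  have h1 := stalkMap_retract i r hir x hx
  have h2 : (q.stalkMap (i.base x) ≫ i.stalkMap x) ≫ (X.presheaf.stalkCongr (.of_eq hx)).inv ≫
      r.stalkMap (i.base x) = q.stalkMap (i.base x) := by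
    rw [← Scheme.Hom.stalkMap_comp]
    have hc := Scheme.Hom.stalkMap_congr_point (i ≫ q) (r.base (i.base x)) x hx
    have hc' : (i ≫ q).stalkMap x =
        (T.presheaf.stalkCongr (.of_eq <| congrArg (fun z => (i ≫ q).base z) hx)).inv ≫
          (i ≫ q).stalkMap (r.base (i.base x)) ≫ (X.presheaf.stalkCongr (.of_eq hx)).hom := by
      rw [Iso.eq_inv_comp]
      exact hc.symm
    rw [hc']
    erw [Category.assoc, Category.assoc, Iso.hom_inv_id_assoc, ← Scheme.Hom.stalkMap_comp,
      Scheme.Hom.stalkMap_congr_hom (r ≫ i ≫ q) q hr (i.base x)]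
    simp [TopCat.Presheaf.stalkCongr]
  rw [Scheme.Hom.stalkMap_comp]
  change ((i.stalkMap x).hom.comp (q.stalkMap (i.base x)).hom).Flat
  refine ringHom_flat_comp_of_retract _ hφ _ ((X.presheaf.stalkCongr (.of_eq hx)).inv ≫
    r.stalkMap (i.base x)).hom ?_ ?_
  · have := congrArg (fun f => CommRingCat.Hom.hom f) h1
    simpa [← CommRingCat.hom_comp, Category.assoc] using this
  · have := congrArg (fun f => CommRingCat.Hom.hom f) h2
    simpa [← CommRingCat.hom_comp, Category.assoc] using this

/-- **The target of a retraction from a connected space is connected** (continuous surjective image). [folklore] -/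
private theorem connectedSpace_of_retract (hir : i ≫ r = 𝟙 X) [ConnectedSpace Y] : ConnectedSpace X := by
  have hsurj : Function.Surjective r.base := fun x => ⟨i.base x, by
    have := congr($(hir).base x)
    simpa using this⟩
  exact hsurj.connectedSpace r.base.hom.continuous

end Retract

namespace AbelianSchemeOver

variable {S : Scheme.{u}}

/-! ## §1 Products of abelian schemes -/

section Prod

variable (A B : AbelianSchemeOver S)

/-- `A ×_S B → S` is proper. [cite: MumfordFogartyKirwan1994, Ch. 6 §1 Definition 6.1 (p. 115)] -/
theorem isProper_tensorObj_hom' : IsProper (A.X ⊗ B.X).hom := by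
  haveI := A.isProper
  haveI := B.isProper
  change IsProper (pullback.fst A.X.hom B.X.hom ≫ A.X.hom)
  infer_instance

/-- `A ×_S B → S` is smooth. [cite: MumfordFogartyKirwan1994, Ch. 6 §1 Definition 6.1 (p. 115)] -/
theorem smooth_tensorObj_hom' : Smooth (A.X ⊗ B.X).hom := by
  haveI := A.isSmooth
  haveI := B.isSmooth
  change Smooth (pullback.fst A.X.hom B.X.hom ≫ A.X.hom)
  infer_instance

/-- `A ×_S B → S` has geometrically connected fibres (Mathlib `GeometricallyConnected.comp` for universally open
morphisms; smooth morphisms are universally open, ★ `universallyOpen_hom`).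
[cite: MumfordFogartyKirwan1994, Ch. 6 §1 Definition 6.1 (p. 115)] -/
theorem geometricallyConnected_tensorObj_hom' : GeometricallyConnected (A.X ⊗ B.X).hom := by
  haveI := A.geometricallyConnected
  haveI := B.geometricallyConnected
  haveI : UniversallyOpen A.X.hom := A.universallyOpen_hom
  haveI : UniversallyOpen B.X.hom := B.universallyOpen_hom
  change GeometricallyConnected (pullback.fst A.X.hom B.X.hom ≫ A.X.hom)
  exact GeometricallyConnected.comp _ _

/-- **The product abelian scheme `A ×_S B`**: the product group object `A.X ⊗ B.X` of the cartesian-monoidal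
`Over S` (Mathlib `GrpObj.instTensorObj`), proper, smooth, with geometrically connected fibres.
[cite: MumfordFogartyKirwan1994, Ch. 6 §1 Definition 6.1 (p. 115)] -/
def prod : AbelianSchemeOver S where
  X := A.X ⊗ B.X
  isProper := isProper_tensorObj_hom' A B
  isSmooth := smooth_tensorObj_hom' A B
  geometricallyConnected := geometricallyConnected_tensorObj_hom' A B

/-- `A ×_S B` is commutative when `A` and `B` are. [cite: MumfordFogartyKirwan1994, Ch. 6 §1 Corollary 6.5 (p. 117)] -/
theorem isCommMonObj_prod [IsCommMonObj A.X] [IsCommMonObj B.X] : IsCommMonObj (A.prod B).X := by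
  change IsCommMonObj (A.X ⊗ B.X)
  infer_instance

/-- `𝟙 S` is geometrically connected (its geometric fibres are spectra of fields). [folklore] -/
private theorem geometricallyConnected_id (S : Scheme.{u}) : GeometricallyConnected (𝟙 S) := by
  refine ⟨fun K _ y Z fst snd hP => ?_⟩
  haveI : IsIso snd := hP.isIso_snd_of_isIso
  exact ObjectProperty.prop_of_iso (P := fun X : Scheme => ConnectedSpace X) (asIso snd).symm
    (inferInstance : ConnectedSpace (Spec (.of K)))

/-- `S → S` (the tensor unit of `Over S`) is proper, smooth and geometrically connected. [folklore] -/
private theorem tensorUnit_hom_props :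
    IsProper (𝟙_ (Over S)).hom ∧ Smooth (𝟙_ (Over S)).hom ∧ GeometricallyConnected (𝟙_ (Over S)).hom := by
  rw [Over.tensorUnit_hom]
  exact ⟨inferInstanceAs (IsProper (𝟙 S)), inferInstanceAs (Smooth (𝟙 S)), geometricallyConnected_id S⟩

variable (S) in
/-- **The trivial abelian scheme `S → S`** (the unit group object `𝟙_ (Over S)`, Mathlib `GrpObj.instTensorUnit`).
[cite: MumfordFogartyKirwan1994, Ch. 6 §1 Definition 6.1 (p. 115)] -/
def trivial : AbelianSchemeOver S where
  X := 𝟙_ (Over S)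
  grpObj := (Grp.trivial (Over S)).grp
  isProper := tensorUnit_hom_props.1
  isSmooth := tensorUnit_hom_props.2.1
  geometricallyConnected := tensorUnit_hom_props.2.2

/-- The carrier of the trivial abelian scheme is `𝟙_ (Over S)`. [cite: MumfordFogartyKirwan1994, Ch. 6 §1 Definition 6.1 (p. 115)] -/
@[simp] theorem trivial_X : (trivial S).X = 𝟙_ (Over S) := rfl

/-- **The power `Aⁿ = A ×_S ⋯ ×_S A`** (`A⁰ = S`, `Aⁿ⁺¹ = Aⁿ ×_S A`). [cite: MumfordFogartyKirwan1994, Ch. 6 §1 Definition 6.1 (p. 115)] -/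
def pow : ℕ → AbelianSchemeOver S
  | 0 => trivial S
  | n + 1 => (pow n).prod A

/-- `A⁰ = S`. [cite: MumfordFogartyKirwan1994, Ch. 6 §1 Definition 6.1 (p. 115)] -/
@[simp] theorem pow_zero : A.pow 0 = trivial S := rfl

/-- `Aⁿ⁺¹ = Aⁿ ×_S A`. [cite: MumfordFogartyKirwan1994, Ch. 6 §1 Definition 6.1 (p. 115)] -/
@[simp] theorem pow_succ (n : ℕ) : A.pow (n + 1) = (A.pow n).prod A := rfl

/-- `Aⁿ` is commutative when `A` is. [cite: MumfordFogartyKirwan1994, Ch. 6 §1 Corollary 6.5 (p. 117)] -/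
theorem isCommMonObj_pow [IsCommMonObj A.X] : ∀ n : ℕ, IsCommMonObj (A.pow n).X
  | 0 => by
    change IsCommMonObj (𝟙_ (Over S))
    infer_instance
  | n + 1 => by
    haveI := isCommMonObj_pow n
    exact isCommMonObj_prod (A.pow n) A

end Prod

/-! ## §2 The fixed subgroup scheme of an idempotent endomorphism -/

section Fixed

variable {B : AbelianSchemeOver S} (e : B.X ⟶ B.X) [IsMonHom e]

/-- The endomorphism `e` as a morphism of group objects `B ⟶ B` in `Grp (Over S)`. [cite: GortzWedhorn2020, Definition 9.1 (3) and Proposition 9.3] -/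
abbrev endGrp : B.toGrp ⟶ B.toGrp := Grp.homMk e

/-- The fixed subgroup scheme `Fix(e) = Eq(e, 𝟙)` as a GROUP object: the equalizer of `e` and `𝟙` in `Grp (Over S)`
(Mathlib: `Grp C` has limits, created by the forgetful functor). [cite: GortzWedhorn2020, Definition 9.1 (3) and Proposition 9.3] -/
def fixedGrp : Grp (Over S) := equalizer (endGrp e) (𝟙 B.toGrp)

/-- The fixed subgroup scheme `Fix(e)` as an `S`-scheme (its group structure is Mathlib's instance `Grp.grp`). [cite: GortzWedhorn2020, Definition 9.1 (3) and Proposition 9.3] -/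
abbrev fixedOver : Over S := (fixedGrp e).X

/-- The inclusion `ι : Fix(e) ⟶ B`, a homomorphism of `S`-group schemes (Mathlib's instance `Mon.Hom.isMonHom_hom`).
[cite: GortzWedhorn2020, Definition 9.1 (3) and Proposition 9.3] -/
abbrev fixedι : fixedOver e ⟶ B.X := (equalizer.ι (endGrp e) (𝟙 B.toGrp)).hom.hom

/-- `ι` is a homomorphism of `S`-group schemes (Mathlib's `Mon.Hom.isMonHom_hom`, recorded by name). [cite: GortzWedhorn2020, Definition 9.1 (3) and Proposition 9.3] -/
theorem isMonHom_fixedι : IsMonHom (fixedι e) := Mon.Hom.isMonHom_hom _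

/-- `ι ≫ e = ι`. [cite: GortzWedhorn2020, Definition 9.1 (3) and Proposition 9.3] -/
@[reassoc]
theorem fixedι_comp : fixedι e ≫ e = fixedι e := by
  have h := equalizer.condition (endGrp e) (𝟙 B.toGrp)
  have h' := congrArg (fun f => f.hom.hom) h
  simp only [Grp.comp_hom_hom, Grp.homMk_hom_hom, Category.comp_id] at h'
  exact h'

/-- The comparison morphism `Fix(e) ⟶ Eq(e, 𝟙)` to the equalizer computed in `Over S`. [cite: GortzWedhorn2020, Definition 9.1 (3) and Proposition 9.3] -/
def fixedToEqualizer : fixedOver e ⟶ equalizer e (𝟙 B.X) :=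
  equalizer.lift (fixedι e) (by rw [fixedι_comp, Category.comp_id])

/-- `Fix(e) ⟶ Eq(e, 𝟙) ⟶ B` is `ι`. [cite: GortzWedhorn2020, Definition 9.1 (3) and Proposition 9.3] -/
@[reassoc (attr := simp)]
theorem fixedToEqualizer_ι : fixedToEqualizer e ≫ equalizer.ι e (𝟙 B.X) = fixedι e :=
  equalizer.lift_ι _ _

/-- The comparison morphism is an isomorphism: the forgetful functor `Grp (Over S) ⥤ Over S` preserves (indeed
creates) limits (Mathlib). [cite: GortzWedhorn2020, Definition 9.1 (3) and Proposition 9.3] -/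
theorem isIso_fixedToEqualizer : IsIso (fixedToEqualizer e) := by
  have h : fixedToEqualizer e = equalizerComparison (endGrp e) (𝟙 B.toGrp) (Grp.forget (Over S)) := by
    apply equalizer.hom_ext
    rw [fixedToEqualizer_ι]
    exact (equalizerComparison_comp_π (endGrp e) (𝟙 B.toGrp) (Grp.forget (Over S))).symm
  haveI : PreservesLimit (parallelPair (endGrp e) (𝟙 B.toGrp)) (Grp.forget (Over S)) := inferInstance
  have hiso : IsIso (equalizerComparison (endGrp e) (𝟙 B.toGrp) (Grp.forget (Over S))) := inferInstance
  rw [h]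
  exact hiso

/-- Isomorphisms of `Over S` have isomorphisms as underlying maps (`Over.forget` maps isos to isos). [cite: GortzWedhorn2020, Definition 9.1 (3) and Proposition 9.3] -/
theorem isIso_left_of_isIso {X Y : Over S} (f : X ⟶ Y) [IsIso f] : IsIso f.left :=
  inferInstanceAs (IsIso ((Over.forget S).map f))

/-- `ι : Fix(e) → B` is a closed immersion (`B → S` is separated). [cite: GortzWedhorn2020, Definition 9.1 (3) and Proposition 9.3] -/
theorem isClosedImmersion_fixedι_left : IsClosedImmersion (fixedι e).left := by
  haveI := B.isProper
  haveI := isIso_fixedToEqualizer e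
  haveI := isIso_left_of_isIso (fixedToEqualizer e)
  rw [← fixedToEqualizer_ι, Over.comp_left]
  infer_instance

/-- `ι : Fix(e) → B` is locally of finite presentation (`B → S` is locally of finite type; ★
`locallyOfFinitePresentation_equalizer_ι_left`). [cite: GortzWedhorn2020, Definition 9.1 (3) and Proposition 9.3] -/
theorem locallyOfFinitePresentation_fixedι_left : LocallyOfFinitePresentation (fixedι e).left := by
  haveI := B.isSmooth
  haveI := isIso_fixedToEqualizer e
  haveI := Literature.AlgebraicGeometry.GroupActions.locallyOfFinitePresentation_equalizer_ι_left e (𝟙 B.X)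
  haveI := isIso_left_of_isIso (fixedToEqualizer e)
  rw [← fixedToEqualizer_ι, Over.comp_left]
  infer_instance

variable (he : e ≫ e = e)

/-- For an IDEMPOTENT `e`, the co-restriction `π : B ⟶ Fix(e)` of `e` (a homomorphism). [cite: GortzWedhorn2020, Definition 9.1 (3) and Proposition 9.3] -/
abbrev fixedπ : B.X ⟶ fixedOver e :=
  (equalizer.lift (endGrp e) (by ext; simp [he]) : B.toGrp ⟶ fixedGrp e).hom.hom

/-- `π` is a homomorphism of `S`-group schemes. [cite: GortzWedhorn2020, Definition 9.1 (3) and Proposition 9.3] -/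
theorem isMonHom_fixedπ : IsMonHom (fixedπ e he) := Mon.Hom.isMonHom_hom _

/-- `π ≫ ι = e`. [cite: GortzWedhorn2020, Definition 9.1 (3) and Proposition 9.3] -/
@[reassoc (attr := simp)]
theorem fixedπ_comp_ι : fixedπ e he ≫ fixedι e = e := by
  have h := equalizer.lift_ι (endGrp e) (by ext; simp [he] : endGrp e ≫ endGrp e = endGrp e ≫ 𝟙 B.toGrp)
  have h' := congrArg (fun f => f.hom.hom) h
  simp only [Grp.comp_hom_hom, Grp.homMk_hom_hom] at h'
  exact h'

/-- `ι ≫ π = 𝟙`: `Fix(e)` is a RETRACT of `B` (over `S`, by homomorphisms). [cite: GortzWedhorn2020, Definition 9.1 (3) and Proposition 9.3] -/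
@[reassoc (attr := simp)]
theorem fixedι_comp_π : fixedι e ≫ fixedπ e he = 𝟙 (fixedOver e) := by
  have h : equalizer.ι (endGrp e) (𝟙 B.toGrp) ≫
      equalizer.lift (endGrp e) (by ext; simp [he] : endGrp e ≫ endGrp e = endGrp e ≫ 𝟙 B.toGrp) = 𝟙 _ := by
    apply equalizer.hom_ext
    rw [Category.assoc, equalizer.lift_ι, Category.id_comp]
    exact equalizer.condition _ _
  have h' := congrArg (fun f => f.hom.hom) h
  simp only [Grp.comp_hom_hom, Grp.id_hom_hom] at h'
  exact h'

/-- `ι` is a monomorphism (of `Over S`). [cite: GortzWedhorn2020, Definition 9.1 (3) and Proposition 9.3] -/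
theorem mono_fixedι : Mono (fixedι e) := by
  haveI := isIso_fixedToEqualizer e
  rw [← fixedToEqualizer_ι]
  infer_instance

/-- **Universal property of `Fix(e)` (idempotent `e`)**: a `T`-point `f` of `B` with `f ≫ e = f` factors through `ι` as
`f ≫ π` (uniquely, `mono_fixedι`). [cite: GortzWedhorn2020, Definition 9.1 (3) and Proposition 9.3] -/
@[reassoc]
theorem comp_fixedπ_comp_fixedι {T : Over S} (f : T ⟶ B.X) (hf : f ≫ e = f) :
    (f ≫ fixedπ e he) ≫ fixedι e = f := by
  rw [Category.assoc, fixedπ_comp_ι, hf]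

/-- A `T`-point of `Fix(e)` is `(its image in B) ≫ π`. [cite: GortzWedhorn2020, Definition 9.1 (3) and Proposition 9.3] -/
theorem eq_comp_fixedι_comp_fixedπ {T : Over S} (t : T ⟶ fixedOver e) : t = (t ≫ fixedι e) ≫ fixedπ e he := by
  rw [Category.assoc, fixedι_comp_π, Category.comp_id]

/-- The `T`-points of `Fix(e)` are the `T`-points `f` of `B` with `f ≫ e = f` (bijection `t ↦ t ≫ ι`, inverse `f ↦ f ≫ π`).
[cite: GortzWedhorn2020, Definition 9.1 (3) and Proposition 9.3] -/
def homEquiv (T : Over S) : (T ⟶ fixedOver e) ≃ {f : T ⟶ B.X // f ≫ e = f} where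
  toFun t := ⟨t ≫ fixedι e, by rw [Category.assoc, fixedι_comp]⟩
  invFun f := f.1 ≫ fixedπ e he
  left_inv t := (eq_comp_fixedι_comp_fixedπ e he t).symm
  right_inv f := Subtype.ext (comp_fixedπ_comp_fixedι e he f.1 f.2)

/-- `homEquiv t = t ≫ ι`. [cite: GortzWedhorn2020, Definition 9.1 (3) and Proposition 9.3] -/
@[simp] theorem homEquiv_apply_coe {T : Over S} (t : T ⟶ fixedOver e) : (homEquiv e he T t : T ⟶ B.X) = t ≫ fixedι e := rfl

/-- `homEquiv⁻¹ f = f ≫ π`. [cite: GortzWedhorn2020, Definition 9.1 (3) and Proposition 9.3] -/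
@[simp] theorem homEquiv_symm_apply {T : Over S} (f : {f : T ⟶ B.X // f ≫ e = f}) :
    (homEquiv e he T).symm f = f.1 ≫ fixedπ e he := rfl

/-- `homEquiv` is multiplicative: `(t * t') ≫ ι = (t ≫ ι) * (t' ≫ ι)` (`ι` is a homomorphism). [cite: GortzWedhorn2020, Definition 9.1 (3) and Proposition 9.3] -/
theorem homEquiv_mul {T : Over S} (t t' : T ⟶ fixedOver e) :
    (homEquiv e he T (t * t') : T ⟶ B.X) = (homEquiv e he T t : T ⟶ B.X) * (homEquiv e he T t' : T ⟶ B.X) := by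
  haveI := isMonHom_fixedι e
  simp only [homEquiv_apply_coe, MonObj.mul_comp]

/-! ## §3 `Fix(e)` is an abelian scheme (idempotent `e`) -/

/-- The structure morphism of `Fix(e)` is `ι` followed by that of `B`. [cite: GortzWedhorn2020, Definition 9.1 (3) and Proposition 9.3] -/
theorem fixedOver_hom : (fixedOver e).hom = (fixedι e).left ≫ B.X.hom := (Over.w (fixedι e)).symm

/-- On underlying schemes, `ι ≫ π = 𝟙`. [cite: GortzWedhorn2020, Definition 9.1 (3) and Proposition 9.3] -/
@[reassoc]
theorem fixedι_left_comp_fixedπ_left : (fixedι e).left ≫ (fixedπ e he).left = 𝟙 _ := by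
  rw [← Over.comp_left, fixedι_comp_π, Over.id_left]

/-- On underlying schemes, `π ≫ ι ≫ (B → S) = (B → S)`. [cite: GortzWedhorn2020, Definition 9.1 (3) and Proposition 9.3] -/
@[reassoc]
theorem fixedπ_left_comp_fixedι_left_comp_hom :
    (fixedπ e he).left ≫ (fixedι e).left ≫ B.X.hom = B.X.hom := by
  rw [← Category.assoc, ← Over.comp_left, fixedπ_comp_ι, Over.w e]

/-- `Fix(e) → S` is proper (closed subscheme of the proper `B`). [cite: MumfordFogartyKirwan1994, Ch. 6 §1 Definition 6.1 (p. 115)] -/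
theorem isProper_fixedOver_hom : IsProper (fixedOver e).hom := by
  haveI := B.isProper
  haveI := isClosedImmersion_fixedι_left e
  rw [fixedOver_hom]
  infer_instance

/-- `Fix(e) → S` is locally of finite presentation. [cite: GortzWedhorn2020, (9.1.4) and Prop. 9.5] -/
theorem locallyOfFinitePresentation_fixedOver_hom : LocallyOfFinitePresentation (fixedOver e).hom := by
  haveI := B.isSmooth
  haveI := locallyOfFinitePresentation_fixedι_left e
  rw [fixedOver_hom]
  infer_instance

include he in
/-- `Fix(e) → S` is FLAT for idempotent `e`: `Fix(e)` is a retract of the flat `B` over `S` (★ `flat_comp_of_retract`).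
[cite: GortzWedhorn2020, Definition/Proposition B.16] -/
theorem flat_fixedOver_hom : Flat (fixedOver e).hom := by
  haveI := B.isSmooth
  rw [fixedOver_hom]
  exact flat_comp_of_retract (fixedι e).left (fixedπ e he).left (fixedι_left_comp_fixedπ_left e he) B.X.hom
    (fixedπ_left_comp_fixedι_left_comp_hom e he)

include he in
/-- `Fix(e) → S` is GEOMETRICALLY REDUCED for idempotent `e`: every geometric fibre is a retract of the smooth (hence
reduced, ★ `isReduced_of_smooth_over_field`) fibre of `B`. [cite: GortzWedhorn2023, Definition 27.89 and Proposition 27.92] -/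
theorem geometricallyReduced_fixedOver_hom : GeometricallyReduced (fixedOver e).hom := by
  haveI := B.isSmooth
  refine ⟨fun K _ y Z fst snd hP ↦ ?_⟩
  haveI : IsReduced (pullback B.X.hom y) := Motives.isReduced_of_smooth_over_field (pullback.snd B.X.hom y)
  let i' : Z ⟶ pullback B.X.hom y := pullback.lift (fst ≫ (fixedι e).left) snd (by
    rw [Category.assoc, ← fixedOver_hom]; exact hP.w)
  let r' : pullback B.X.hom y ⟶ Z := hP.lift (pullback.fst B.X.hom y ≫ (fixedπ e he).left) (pullback.snd B.X.hom y)
    (by rw [Category.assoc, fixedOver_hom, fixedπ_left_comp_fixedι_left_comp_hom]; exact pullback.condition)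
  have h : i' ≫ r' = 𝟙 Z := by
    apply hP.hom_ext
    · rw [Category.assoc, hP.lift_fst, ← Category.assoc, pullback.lift_fst, Category.assoc,
        fixedι_left_comp_fixedπ_left, Category.comp_id, Category.id_comp]
    · rw [Category.assoc, hP.lift_snd, pullback.lift_snd, Category.id_comp]
  exact isReduced_of_retract i' r' h

include he in
/-- `Fix(e) → S` has GEOMETRICALLY CONNECTED fibres for idempotent `e`: every geometric fibre is the image under `π`
of the connected geometric fibre of `B`. [cite: MumfordFogartyKirwan1994, Ch. 6 §1 Definition 6.1 (p. 115)] -/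
theorem geometricallyConnected_fixedOver_hom : GeometricallyConnected (fixedOver e).hom := by
  refine ⟨fun K _ y Z fst snd hP ↦ ?_⟩
  haveI : ConnectedSpace ↥(pullback B.X.hom y) := B.connectedSpace_pullback K y
  let i' : Z ⟶ pullback B.X.hom y := pullback.lift (fst ≫ (fixedι e).left) snd (by
    rw [Category.assoc, ← fixedOver_hom]; exact hP.w)
  let r' : pullback B.X.hom y ⟶ Z := hP.lift (pullback.fst B.X.hom y ≫ (fixedπ e he).left) (pullback.snd B.X.hom y)
    (by rw [Category.assoc, fixedOver_hom, fixedπ_left_comp_fixedι_left_comp_hom]; exact pullback.condition)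
  have h : i' ≫ r' = 𝟙 Z := by
    apply hP.hom_ext
    · rw [Category.assoc, hP.lift_fst, ← Category.assoc, pullback.lift_fst, Category.assoc,
        fixedι_left_comp_fixedπ_left, Category.comp_id, Category.id_comp]
    · rw [Category.assoc, hP.lift_snd, pullback.lift_snd, Category.id_comp]
  exact connectedSpace_of_retract i' r' h

include he in
/-- `Fix(e) → S` is SMOOTH for idempotent `e`: flat, locally of finite presentation, and every fibre is a geometrically
reduced group scheme locally of finite type over a field, hence smooth (Mathlib `smooth_of_grpObj`,
`Smooth.of_smooth_fiberToSpecResidueField`). [cite: GortzWedhorn2023, Corollary 27.24 (with Proposition 27.10 (1) and Theorem 18.56)] -/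
theorem smooth_fixedOver_hom : Smooth (fixedOver e).hom := by
  haveI := flat_fixedOver_hom e he
  haveI := locallyOfFinitePresentation_fixedOver_hom e
  haveI := geometricallyReduced_fixedOver_hom e he
  haveI : LocallyOfFiniteType (fixedOver e).hom := inferInstance
  refine Smooth.of_smooth_fiberToSpecResidueField _ fun s => ?_
  haveI : LocallyOfFiniteType ((fixedOver e).hom.fiberToSpecResidueField s) :=
    inferInstanceAs (LocallyOfFiniteType (pullback.snd (fixedOver e).hom (S.fromSpecResidueField s)))
  haveI : GrpObj (Over.mk (fixedOver e).hom) := inferInstanceAs (GrpObj (fixedOver e))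
  haveI hG : GrpObj (Over.mk ((fixedOver e).hom.fiberToSpecResidueField s)) :=
    Over.grpObjMkPullbackSnd (f := (fixedOver e).hom) (g := S.fromSpecResidueField s)
  have hR : GeometricallyReduced ((fixedOver e).hom.fiberToSpecResidueField s) := inferInstance
  exact @smooth_of_grpObj _ _ _ ((fixedOver e).hom.fiberToSpecResidueField s) ‹_› hG hR

include he in
/-- **The image `Fix(e) = e(B)` of an idempotent endomorphism `e` of an abelian scheme `B/S` is an abelian scheme**
(a direct factor of `B`: `ι : Fix(e) ↪ B` a closed subgroup scheme, `π : B ↠ Fix(e)` with `ι ≫ π = 𝟙`, `π ≫ ι = e`);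
the carrier of the Serre tensor construction `A ⊗_𝒪 𝔟 = Fix(E ↷ Aⁿ)` for a finitely generated projective `𝔟 = E·𝒪ⁿ`.
[cite: GortzWedhorn2023, Definition 27.89 and Proposition 27.92] [cite: MumfordFogartyKirwan1994, Ch. 6 §1 Definition 6.1 (p. 115)] -/
def fixed : AbelianSchemeOver S where
  X := fixedOver e
  isProper := isProper_fixedOver_hom e
  isSmooth := smooth_fixedOver_hom e he
  geometricallyConnected := geometricallyConnected_fixedOver_hom e he

/-- The carrier of `Fix(e)`. [cite: GortzWedhorn2020, Definition 9.1 (3) and Proposition 9.3] -/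
@[simp] theorem fixed_X : (fixed e he).X = fixedOver e := rfl

/-- `Fix(e)` is commutative when `B` is (its points form a subgroup of those of `B`).
[cite: MumfordFogartyKirwan1994, Ch. 6 §1 Corollary 6.5 (p. 117)] -/
theorem isCommMonObj_fixedOver [IsCommMonObj B.X] : IsCommMonObj (fixedOver e) := by
  rw [isCommMonObj_iff_isMulCommutative]
  intro T
  refine ⟨⟨fun f g => ?_⟩⟩
  haveI : Mono (fixedι e) := by
    haveI := isIso_fixedToEqualizer e
    rw [← fixedToEqualizer_ι]
    infer_instance
  haveI := isMonHom_fixedι e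
  rw [← cancel_mono (fixedι e), MonObj.mul_comp, MonObj.mul_comp, mul_comm]

end Fixed

end AbelianSchemeOver

end Literature.AlgebraicGeometry.AbelianSchemes

end
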